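import Summits.ABC.IUTFork.Cor312GenuineKWildLowerBound
import Literature.IUT.LogVolume.EisensteinRadicalDifferent
import Literature.IUT.LogVolume.DifferentOrdDivisor
import Literature.IUT.LogVolume.Corollary22RatPointDictionary
import Literature.NumberTheory.EllipticCurves.TateCurve.TorsionRootTwist
import Literature.NumberTheory.EllipticCurves.TateJTransport
import HarnessLib

/-!
# [IUTchIII] Cor. 3.12, branch C / R-W window table — the WILD different at the `K`-level pilot datum:
# at every fibre point `x₀ ∣ p ∈ {3, 5}` over a pole of `j` of order `2t` with `p ∤ t` (type W1),
# `p ∣ e(K_{x₀}/ℚ_p)` and `v(𝔇_{K_{x₀}/ℚ_p}) ≥ 2e − 1 ≥ (e/p)(2p − 1)`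

PROOF-ONLY support file (D-0012; 0 definitions, 0 `Prop` facts) of the abc-iut cell (R-W «WINDOW Θ-SIDE INEQUALITY», seat
abc-iut-W-neg-1 gen 2; GAP G-Wnum2-1 «WILD LOCAL-TYPE LEMMA», narrowed consumer form D-G-Wnum2-1 (ii)). TAKES NO SIDE on
[IUTchIII] Cor. 3.12 (S. Mochizuki, *Inter-universal Teichmüller theory III*, Cor. 3.12 p. 173–174) or on any author.

For a genuine Θ-volume datum `T : Cor22.ThetaVolumeDatumAt (ratPoint q) l` ([IUTchIV] Thm. 1.10: the `30`-torsion of `E_F`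
is `F`-rational), a prime `p ∈ {3, 5}` (`p ∣ 30`, `p ≠ 2`) at which `j(q)` has a pole of order `2t` with `p ∤ t`, and EVERY
fibre point `x₀ ∣ p` of the pilot datum `pilotDataOfK T.D T.K` (completion `K_{x₀} = kOf … x₀`, a normed `ℚ_p`-algebra):

* `GenuineK.exists_pow_prime_eq_kOf_ratPoint` — **an Eisenstein radical in `K_{x₀}`**: `∃ π ∈ ℚ_p`, `‖π‖ = p⁻¹`, and
  `y ∈ K_{x₀}` with `y^p = π`. Route (Silverman ATAEC V.5.3, the tree's `exists_tateParameter_pow_of_odd_torsion` — odd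
  rational torsion kills the twist, no reduction hypothesis): the `p²` `F`-rational `p`-torsion points of `E_F` map to
  `K_{x₀}`-points of `E_F ⊗ K_{x₀}`, whose `j`-invariant `j(q) ∈ ℚ ⊆ ℚ_p` has `|j|_p = p^{2t} > 1`
  (`Cor22.ord_eq_padicValRat`), so the Tate parameter `q_E ∈ K_{x₀}` is a `p`-th power `ρ^p`; by `tateJ_algebraMap` and
  uniqueness of the Tate parameter, `q_E = q₀ · 1` for the `ℚ_p`-Tate parameter `q₀` (`v_p(q₀) = 2t`); with
  `α·2t = β·p + 1` the element `y := ρ^α/p^β` has `y^p = q₀^α/p^{βp} =: π`, `v_p(π) = 1`.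
* hence, by this seat's `Literature.IUT.LogVolume.EisensteinRadicalDifferent` (classical: Serre III §6 Prop. 13, Ore's
  bound attained): **`GenuineK.prime_dvd_absRamificationIdx_kOf_wild_ratPoint`** (`p ∣ e(K_{x₀}/ℚ_p)`),
  **`GenuineK.sub_one_div_le_differentOrd_kOf_wild_ratPoint`** (`(2e − 1)/e ≤ d(K_{x₀})`), the consumer form
  **`GenuineK.div_mul_le_mul_differentOrd_kOf_wild_ratPoint`** (`(e/p)(2p − 1) ≤ e·d(K_{x₀})` — D-G-Wnum2-1 (ii) verbatim),
  and the global form `GenuineK.sub_one_le_multiplicity_differentIdeal_placeOf_wild_ratPoint`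
  (`2e − 1 ≤ ord_u 𝔇_{K/ℤ}` at `u = placeOf x₀`).

HONEST FRAMING: bookkeeping over OUR typed objects (classical Tate-curve and local-field theory); nothing here bears on the
printed inequality of [IUTchIII] Cor. 3.12 or on the number-level `Cor22.Cor312AtDatum`; typed ≠ proved; instantiated ≠ endorsed.
[cite: Mochizuki2012, IUTchIV Thm. 1.10 p. 22] [cite: SilvermanATAEC1994, V.5 Thm. 5.3 and Lemma V.5.1 (PDF pp. 406–409)]
[cite: SerreLocalFields1979, Ch. III §6 Prop. 13] [claim: Mochizuki2012, status: disputed] for every IUT quotation.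
-/

noncomputable section

open NumberField IsDedekindDomain

namespace Summit.ABC.IUTFork.Conditional

open Thm311 Thm311.Real Cor312 Cor312Prov Literature.IUT.LogVolume Literature.IUT.HodgeTheaters
  Literature.IUT.LogThetaLattice Literature.NumberTheory.NumberFields Literature.NumberTheory.DiophantineGeometry.GenEll
  Literature.NumberTheory.DiophantineGeometry Literature.NumberTheory.EllipticCurves
  Literature.NumberTheory.EllipticCurves.TateCurve

/-! ## 0. Dictionary: `ord_v = v_p` on `ℚ`, and torsion points in a field extension -/

/-- **`ord_v(x) = v_{p_v}(x)`** on `ℚ^×`: the tree's `ord` at the finite place of `ℚ` with generator `p` IS the `p`-adic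
valuation `padicValRat p` (numerator and denominator through `Cor22.ord_natCast_eq_factorization`). [cite: DupuyHilado2025, §2.4.2] -/
theorem GenuineK.ord_rat_eq_padicValRat (v : HeightOneSpectrum (𝓞 ℚ)) {x : ℚ} (hx : x ≠ 0) :
    Literature.IUT.LogVolume.ord ℚ v x = padicValRat (Rat.HeightOneSpectrum.natGenerator v) x := by
  set p := Rat.HeightOneSpectrum.natGenerator v with hpdef
  have hpp : p.Prime := Rat.HeightOneSpectrum.prime_natGenerator v
  haveI : Fact p.Prime := ⟨hpp⟩
  have hnum : x.num ≠ 0 := Rat.num_ne_zero.mpr hx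
  obtain ⟨N, hN⟩ : ∃ N : ℕ, x.num.natAbs = N := ⟨_, rfl⟩
  have hN0 : N ≠ 0 := by rw [← hN]; exact Int.natAbs_ne_zero.mpr hnum
  have hden0 : x.den ≠ 0 := x.den_nz
  have hNq : (N : ℚ) ≠ 0 := by exact_mod_cast hN0
  have hdenq : (x.den : ℚ) ≠ 0 := by exact_mod_cast hden0
  -- `ord(num) = ord(N)`: the numerator is `±N`
  have hordnum : Literature.IUT.LogVolume.ord ℚ v (x.num : ℚ) = Literature.IUT.LogVolume.ord ℚ v (N : ℚ) := by
    rcases Int.natAbs_eq x.num with h | h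
    · rw [h, hN]; push_cast; rfl
    · rw [h, hN]; push_cast
      unfold Literature.IUT.LogVolume.ord
      rw [Valuation.map_neg]
  have hx' : x = (x.num : ℚ) * ((x.den : ℚ))⁻¹ := by
    rw [← div_eq_mul_inv]; exact (Rat.num_div_den x).symm
  have hnumq : (x.num : ℚ) ≠ 0 := by exact_mod_cast hnum
  conv_lhs => rw [hx']
  rw [ord_mul ℚ v hnumq (inv_ne_zero hdenq), ord_inv, hordnum, Cor22.ord_natCast_eq_factorization v hN0,
    Cor22.ord_natCast_eq_factorization v hden0, ← hpdef, padicValRat, padicValInt, hN,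
    Nat.factorization_def N hpp, Nat.factorization_def x.den hpp]
  ring

open scoped Classical in
/-- Push-forward of a finset of `F`-points killed by `n` along a field extension `F → L` (injective on points).
[folklore] -/
private theorem exists_finset_torsion_map {F : Type} [Field F] (E : WeierstrassCurve F) {L : Type} [Field L]
    [Algebra F L] {n : ℕ} (S : Finset (E.toAffine.baseChange F).Point) (hS : ∀ Q ∈ S, n • Q = 0) :
    ∃ S' : Finset (E.baseChange L).toAffine.Point, S'.card = S.card ∧ ∀ Q ∈ S', n • Q = 0 := by
  let f : F →ₐ[F] L := Algebra.ofId F L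
  let ι : (E.toAffine.baseChange F).Point →+ (E.toAffine.baseChange L).Point :=
    WeierstrassCurve.Affine.Point.map f
  have hι : Function.Injective ι := WeierstrassCurve.Affine.Point.map_injective f
  refine ⟨S.map ⟨ι, hι⟩, by rw [Finset.card_map], fun Q hQ => ?_⟩
  obtain ⟨Q₀, hQ₀, rfl⟩ := Finset.mem_map.mp hQ
  show n • ι Q₀ = 0
  rw [← map_nsmul, hS Q₀ hQ₀, map_zero]

/-- `α·k ≡ 1 (mod p)` solvably in naturals: for `k` prime to the prime `p` there are `α, β ∈ ℕ` with `α·k = β·p + 1`.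
[folklore] -/
private theorem exists_mul_eq_mul_add_one {k p : ℕ} (hp : p.Prime) (hk : ¬ p ∣ k) :
    ∃ α β : ℕ, α * k = β * p + 1 := by
  have hcop : Nat.Coprime k p := (Nat.coprime_comm.mp ((Nat.Prime.coprime_iff_not_dvd hp).mpr hk))
  obtain ⟨m, -, hm⟩ := Nat.exists_mul_mod_eq_one_of_coprime hcop hp.one_lt
  refine ⟨m, k * m / p, ?_⟩
  have h := Nat.div_add_mod (k * m) p
  rw [hm] at h
  rw [mul_comm m k, mul_comm (k * m / p) p]
  omega

/-! ## 1. An Eisenstein radical in `K_{x₀}` at a W1 packet -/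

/-- **An Eisenstein radical in `K_{x₀}`**: for a genuine Θ-volume datum `T` at a RATIONAL point `(ratPoint q, l)`, a prime
`p ∈ {3,5}` (`p ∣ 30`, `p ≠ 2`) at which `j(q)` has a pole of order `2t` with `p ∤ t`, and every fibre point `x₀ ∣ p` of the
pilot datum: there are `π ∈ ℚ_p` with `‖π‖ = p⁻¹` and `y ∈ K_{x₀}` with `y^p = π`. (The `p²` rational `p`-torsion points
of `E_F` over `K_{x₀}` make the Tate parameter `q₀ ∈ ℚ_p`, `v_p(q₀) = 2t`, a `p`-th power `ρ^p` in `K_{x₀}` — Silverman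
ATAEC V.5.3 via the tree's `exists_tateParameter_pow_of_odd_torsion`, `tateJ_algebraMap`, `tateParameter_unique` — and
`y = ρ^α/p^β` with `α·2t = β·p + 1`.) [cite: SilvermanATAEC1994, V.5 Thm. 5.3 and Lemma V.5.1 (PDF pp. 406–409)]
[cite: Mochizuki2012, IUTchIV Thm. 1.10 p. 22] [claim: Mochizuki2012, status: disputed] -/
theorem GenuineK.exists_pow_prime_eq_kOf_ratPoint {q : ℚ} {l : ℕ} (T : Cor22.ThetaVolumeDatumAt (ratPoint q) l)
    (pp : Nat.Primes) (hp30 : (pp : ℕ) ∣ 30) (hp2 : (pp : ℕ) ≠ 2) {t : ℕ} (ht : 0 < t) (hpt : ¬ (pp : ℕ) ∣ t)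
    (hpole : ∀ v : HeightOneSpectrum (𝓞 ℚ), Rat.HeightOneSpectrum.natGenerator v = pp →
      Literature.IUT.LogVolume.ord ℚ v (Cor22.jInv q) = -(2 * (t : ℤ))) :
    letI := T.instFieldF; letI := T.instNumberFieldF; letI := T.instAlgebraF; letI := T.instFieldK
    letI := T.instNumberFieldK; letI := T.instAlgebraK; letI := T.instFieldFbar; letI := T.instAlgebraFbar
    letI := T.instAlgebraKFbar; letI := T.instIsElliptic
    haveI : Fact (pp : ℕ).Prime := ⟨pp.2⟩
    ∀ x₀ : (thetaIndex (pilotDataOfK T.D T.K)).Fibre (.inr pp),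
      ∃ (π : ℚ_[pp]) (y : kOf (pilotDataOfK T.D T.K) pp.1 x₀),
        ‖π‖ = ((pp : ℕ) : ℝ)⁻¹ ∧ y ^ (pp : ℕ) = algebraMap ℚ_[pp] (kOf (pilotDataOfK T.D T.K) pp.1 x₀) π := by
  letI := T.instFieldF; letI := T.instNumberFieldF; letI := T.instAlgebraF; letI := T.instFieldK
  letI := T.instNumberFieldK; letI := T.instAlgebraK; letI := T.instFieldFbar; letI := T.instAlgebraFbar
  letI := T.instAlgebraKFbar; letI := T.instIsElliptic
  haveI : Fact (pp : ℕ).Prime := ⟨pp.2⟩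
  have hpp : (pp : ℕ).Prime := pp.2
  set X := pilotDataOfK T.D T.K with hXdef
  intro x₀
  set u := placeOf X pp.1 x₀ with hudef
  have hpu : ((pp : ℕ) : 𝓞 T.K) ∈ u.asIdeal := natCast_mem_placeOf X pp.1 x₀
  -- the completion `K_u` and the structure map `F → K → K_u`
  set Ku : Type := kOf X pp.1 x₀ with hKudef
  let f : T.F →+* Ku :=
    (RescaledCompletion.of T.K pp.1 u hpu).toRingHom.comp
      ((algebraMap T.K (u.adicCompletion T.K)).comp (algebraMap T.F T.K))
  letI algFKu : Algebra T.F Ku := f.toAlgebra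
  haveI : CharZero Ku := charZero_of_injective_algebraMap (algebraMap ℚ_[pp] Ku).injective
  -- the curve `E_F ⊗ K_u` and its `j`-invariant `j(q) ∈ ℚ ⊆ ℚ_p`
  haveI hEK : (T.E.baseChange Ku).IsElliptic := inferInstanceAs (T.E.map (algebraMap T.F Ku)).IsElliptic
  set j₀ : ℚ_[pp] := ((Cor22.jInv q : ℚ) : ℚ_[pp]) with hj₀def
  have hjK : (T.E.baseChange Ku).j = algebraMap ℚ_[pp] Ku j₀ := by
    have h1 : (T.E.baseChange Ku).j = algebraMap T.F Ku T.E.j := T.E.map_j (algebraMap T.F Ku)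
    rw [h1, T.j_eq, hj₀def, map_ratCast]
    exact eq_ratCast ((algebraMap T.F Ku).comp (algebraMap (ratPoint q).F T.F)) (Cor22.jInv q)
  -- the place of `ℚ` under `u` is the pole `p`
  set v : HeightOneSpectrum (𝓞 ℚ) := finBelow (ratPoint q).F T.F (finBelow T.F T.K u) with hvdef
  have huchar : residueChar T.K u = (pp : ℕ) := residueChar_eq_of_natCast_mem pp.1 hpu
  have hvp : Rat.HeightOneSpectrum.natGenerator v = pp := by
    have hchar : residueChar ℚ v = pp := by
      rw [hvdef]
      change residueChar (ratPoint q).F (finBelow (ratPoint q).F T.F (finBelow T.F T.K u)) = pp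
      rw [residueChar_finBelow, residueChar_finBelow, huchar]
    have hmem : ((pp : ℕ) : 𝓞 ℚ) ∈ v.asIdeal := by
      rw [Cor22.natCast_mem_asIdeal_iff_residueChar_eq v pp.2]; exact hchar
    have hdvd := (UniformABCConjecture.natCast_mem_asIdeal_iff v pp).1 hmem
    exact (Nat.prime_dvd_prime_iff_eq (Rat.HeightOneSpectrum.prime_natGenerator v) pp.2).1 hdvd
  -- `|j|_p = p^{2t} > 1`
  have hordj := hpole v hvp
  have hj0 : (Cor22.jInv q : ℚ) ≠ 0 := by
    intro h0
    rw [h0, ord_zero] at hordj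
    have : (0 : ℤ) < t := by exact_mod_cast ht
    omega
  have hval : padicValRat pp (Cor22.jInv q) = -(2 * (t : ℤ)) := by
    rw [← hvp, ← GenuineK.ord_rat_eq_padicValRat v hj0, hordj]
  have hpR1 : (1 : ℝ) < ((pp : ℕ) : ℝ) := by exact_mod_cast hpp.one_lt
  have hpR0 : (0 : ℝ) < ((pp : ℕ) : ℝ) := by positivity
  have hj₀0 : j₀ ≠ 0 := by rw [hj₀def]; exact_mod_cast hj0
  have hj₀norm : ‖j₀‖ = ((pp : ℕ) : ℝ) ^ (((2 * t : ℕ) : ℤ)) := by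
    rw [Padic.norm_eq_zpow_neg_valuation hj₀0, hj₀def, Padic.valuation_ratCast, hval]
    congr 1
    push_cast
    ring
  have hj₀gt : 1 < ‖j₀‖ := by
    rw [hj₀norm]
    exact one_lt_zpow₀ hpR1 (by have : 0 < t := ht; omega)
  have hjKgt : 1 < ‖(T.E.baseChange Ku).j‖ := by rw [hjK, norm_algebraMap']; exact hj₀gt
  -- `p²` rational `p`-torsion points over `K_u`, so the Tate parameter of `E_F ⊗ K_u` is a `p`-th power
  obtain ⟨S, hS, hSp⟩ := T.exists_finset_torsion_F (n := (pp : ℕ)) hpp.pos hp30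
  obtain ⟨S', hS', hS'p⟩ := exists_finset_torsion_map T.E (L := Ku) S hSp
  have hodd : Odd (pp : ℕ) := hpp.odd_of_ne_two hp2
  obtain ⟨qK, ρ, hqK0, hqK1, hqKj, -, hρ⟩ :=
    exists_tateParameter_pow_of_odd_torsion (T.E.baseChange Ku) hjKgt hodd S' hS'p (by rw [hS', hS])
  -- the `ℚ_p`-Tate parameter `q₀` of `j(q)`, and `q_E = q₀·1` by uniqueness
  obtain ⟨q₀, ⟨hq₀0, hq₀1, hq₀j⟩, -⟩ := existsUnique_tateJ_eq_of_one_lt_norm hj₀gt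
  have hq₀K : tateJ (algebraMap ℚ_[pp] Ku q₀) = (T.E.baseChange Ku).j := by
    rw [tateJ_algebraMap Ku hq₀1, hq₀j, hjK]
  have hq₀K0 : algebraMap ℚ_[pp] Ku q₀ ≠ 0 := (map_ne_zero _).mpr hq₀0
  have hq₀K1 : ‖algebraMap ℚ_[pp] Ku q₀‖ < 1 := by rw [norm_algebraMap']; exact hq₀1
  have hqeq : qK = algebraMap ℚ_[pp] Ku q₀ :=
    tateParameter_unique (E := T.E.baseChange Ku) hqK0 hqK1 hqKj hq₀K0 hq₀K1 hq₀K
  have hq₀norm : ‖q₀‖ = ((pp : ℕ) : ℝ) ^ (-(((2 * t : ℕ) : ℤ))) := by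
    have h := norm_tateJ_eq hq₀1
    rw [hq₀j, hj₀norm] at h
    rw [zpow_neg, h, inv_inv]
  -- `α·2t = β·p + 1`
  have hp2t : ¬ (pp : ℕ) ∣ 2 * t := by
    intro h
    rcases (Nat.Prime.dvd_mul hpp).mp h with h2 | h2
    · exact hp2 ((Nat.prime_dvd_prime_iff_eq hpp Nat.prime_two).mp h2)
    · exact hpt h2
  obtain ⟨α, β, hαβ⟩ := exists_mul_eq_mul_add_one hpp hp2t
  -- the radical `y = ρ^α / p^β`, `y^p = q₀^α / p^{βp} =: π`, `v_p(π) = α·2t − β·p = 1`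
  refine ⟨q₀ ^ α / ((pp : ℕ) : ℚ_[pp]) ^ (β * pp), ρ ^ α / ((pp : ℕ) : Ku) ^ β, ?_, ?_⟩
  · have hP : ((pp : ℕ) : ℝ) ≠ 0 := hpR0.ne'
    have key : ‖q₀ ^ α / ((pp : ℕ) : ℚ_[pp]) ^ (β * pp)‖ = ((pp : ℕ) : ℝ) ^ (-(1 : ℤ)) := by
      rw [norm_div, norm_pow, norm_pow, hq₀norm, Padic.norm_p, ← zpow_natCast (((pp : ℕ) : ℝ) ^ (-(((2 * t : ℕ) : ℤ)))) α,
        ← zpow_mul, inv_pow, ← zpow_natCast ((pp : ℕ) : ℝ) (β * pp), ← zpow_neg, ← zpow_sub₀ hP]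
      congr 1
      have h := hαβ
      push_cast
      have h' : ((α : ℤ) * (2 * t) : ℤ) = β * pp + 1 := by exact_mod_cast h
      linarith
    rw [key, zpow_neg, zpow_one]
  · have h1 : (ρ ^ α / ((pp : ℕ) : Ku) ^ β) ^ (pp : ℕ) = (ρ ^ (pp : ℕ)) ^ α / ((pp : ℕ) : Ku) ^ (β * pp) := by
      rw [div_pow, ← pow_mul, ← pow_mul, mul_comm α (pp : ℕ), pow_mul ρ (pp : ℕ) α]
    rw [h1, hρ, hqeq, map_div₀, map_pow, map_pow, map_natCast]

/-! ## 2. Consequences: `p ∣ e`, `(2e − 1)/e ≤ d`, `(e/p)(2p − 1) ≤ e·d`, `2e − 1 ≤ ord_u 𝔇_{K/ℤ}` -/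

/-- **`p ∣ e(K_{x₀}/ℚ_p)` at every fibre point over a W1 wild pole** (`p ∈ {3,5}`, `ord_p j(q) = −2t`, `p ∤ t`): the value
group of `K_{x₀}` contains `p^{−1/p}`. [cite: SerreLocalFields1979, Ch. III §6 Prop. 13] [cite: Mochizuki2012, IUTchIV Thm. 1.10 p. 22]
[claim: Mochizuki2012, status: disputed] -/
theorem GenuineK.prime_dvd_absRamificationIdx_kOf_wild_ratPoint {q : ℚ} {l : ℕ} (T : Cor22.ThetaVolumeDatumAt (ratPoint q) l)
    (pp : Nat.Primes) (hp30 : (pp : ℕ) ∣ 30) (hp2 : (pp : ℕ) ≠ 2) {t : ℕ} (ht : 0 < t) (hpt : ¬ (pp : ℕ) ∣ t)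
    (hpole : ∀ v : HeightOneSpectrum (𝓞 ℚ), Rat.HeightOneSpectrum.natGenerator v = pp →
      Literature.IUT.LogVolume.ord ℚ v (Cor22.jInv q) = -(2 * (t : ℤ))) :
    letI := T.instFieldF; letI := T.instNumberFieldF; letI := T.instAlgebraF; letI := T.instFieldK
    letI := T.instNumberFieldK; letI := T.instAlgebraK; letI := T.instFieldFbar; letI := T.instAlgebraFbar
    letI := T.instAlgebraKFbar; letI := T.instIsElliptic
    haveI : Fact (pp : ℕ).Prime := ⟨pp.2⟩
    ∀ x₀ : (thetaIndex (pilotDataOfK T.D T.K)).Fibre (.inr pp),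
      (pp : ℕ) ∣ absRamificationIdx (pp : ℕ) (kOf (pilotDataOfK T.D T.K) pp.1 x₀) := by
  haveI : Fact (pp : ℕ).Prime := ⟨pp.2⟩
  intro x₀
  obtain ⟨π, y, hπ, hy⟩ := GenuineK.exists_pow_prime_eq_kOf_ratPoint T pp hp30 hp2 ht hpt hpole x₀
  exact prime_dvd_absRamificationIdx_of_pow_prime_eq (pp : ℕ) hπ hy

/-- **`(2e − 1)/e ≤ d(K_{x₀})` at every fibre point over a W1 wild pole** (`e = e(K_{x₀}/ℚ_p)`, `d` the normalised order of
the different, `ord(p) = 1`): the different of `K_{x₀}` is Ore-maximal, `v(𝔇) ≥ 2e − 1 = e − 1 + v_{K_{x₀}}(e)` when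
`v_p(e) = 1` (W-num-2's exact value `δ_w = 2e_w − 1`, N1-WILD-EXACT L4/L5). [cite: SerreLocalFields1979, Ch. III §6 Prop. 13]
[cite: Mochizuki2012, IUTchIV Thm. 1.10 p. 22] [claim: Mochizuki2012, status: disputed] -/
theorem GenuineK.sub_one_div_le_differentOrd_kOf_wild_ratPoint {q : ℚ} {l : ℕ} (T : Cor22.ThetaVolumeDatumAt (ratPoint q) l)
    (pp : Nat.Primes) (hp30 : (pp : ℕ) ∣ 30) (hp2 : (pp : ℕ) ≠ 2) {t : ℕ} (ht : 0 < t) (hpt : ¬ (pp : ℕ) ∣ t)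
    (hpole : ∀ v : HeightOneSpectrum (𝓞 ℚ), Rat.HeightOneSpectrum.natGenerator v = pp →
      Literature.IUT.LogVolume.ord ℚ v (Cor22.jInv q) = -(2 * (t : ℤ))) :
    letI := T.instFieldF; letI := T.instNumberFieldF; letI := T.instAlgebraF; letI := T.instFieldK
    letI := T.instNumberFieldK; letI := T.instAlgebraK; letI := T.instFieldFbar; letI := T.instAlgebraFbar
    letI := T.instAlgebraKFbar; letI := T.instIsElliptic
    haveI : Fact (pp : ℕ).Prime := ⟨pp.2⟩
    ∀ x₀ : (thetaIndex (pilotDataOfK T.D T.K)).Fibre (.inr pp),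
      ((2 * absRamificationIdx (pp : ℕ) (kOf (pilotDataOfK T.D T.K) pp.1 x₀) - 1 : ℕ) : ℝ) /
          (absRamificationIdx (pp : ℕ) (kOf (pilotDataOfK T.D T.K) pp.1 x₀) : ℝ) ≤
        differentOrd (pp : ℕ) (kOf (pilotDataOfK T.D T.K) pp.1 x₀) := by
  haveI : Fact (pp : ℕ).Prime := ⟨pp.2⟩
  intro x₀
  obtain ⟨π, y, hπ, hy⟩ := GenuineK.exists_pow_prime_eq_kOf_ratPoint T pp hp30 hp2 ht hpt hpole x₀
  exact sub_one_div_le_differentOrd_of_pow_prime_eq (pp : ℕ) hπ hy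

/-- **Consumer form `(e/p)·(2p − 1) ≤ e·d(K_{x₀})`** — abc-iut D-G-Wnum2-1 (ii) verbatim («D ≥ (e_w/p)(2p−1) at the W1 packets»), the
weaker consequence of `2e − 1 ≤ e·d`. [cite: SerreLocalFields1979, Ch. III §6 Prop. 13] [cite: Mochizuki2012, IUTchIV Thm. 1.10 p. 22]
[claim: Mochizuki2012, status: disputed] -/
theorem GenuineK.div_mul_le_mul_differentOrd_kOf_wild_ratPoint {q : ℚ} {l : ℕ} (T : Cor22.ThetaVolumeDatumAt (ratPoint q) l)
    (pp : Nat.Primes) (hp30 : (pp : ℕ) ∣ 30) (hp2 : (pp : ℕ) ≠ 2) {t : ℕ} (ht : 0 < t) (hpt : ¬ (pp : ℕ) ∣ t)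
    (hpole : ∀ v : HeightOneSpectrum (𝓞 ℚ), Rat.HeightOneSpectrum.natGenerator v = pp →
      Literature.IUT.LogVolume.ord ℚ v (Cor22.jInv q) = -(2 * (t : ℤ))) :
    letI := T.instFieldF; letI := T.instNumberFieldF; letI := T.instAlgebraF; letI := T.instFieldK
    letI := T.instNumberFieldK; letI := T.instAlgebraK; letI := T.instFieldFbar; letI := T.instAlgebraFbar
    letI := T.instAlgebraKFbar; letI := T.instIsElliptic
    haveI : Fact (pp : ℕ).Prime := ⟨pp.2⟩
    ∀ x₀ : (thetaIndex (pilotDataOfK T.D T.K)).Fibre (.inr pp),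
      ((absRamificationIdx (pp : ℕ) (kOf (pilotDataOfK T.D T.K) pp.1 x₀) / pp * (2 * pp - 1) : ℕ) : ℝ) ≤
        (absRamificationIdx (pp : ℕ) (kOf (pilotDataOfK T.D T.K) pp.1 x₀) : ℝ) *
          differentOrd (pp : ℕ) (kOf (pilotDataOfK T.D T.K) pp.1 x₀) := by
  haveI : Fact (pp : ℕ).Prime := ⟨pp.2⟩
  intro x₀
  obtain ⟨π, y, hπ, hy⟩ := GenuineK.exists_pow_prime_eq_kOf_ratPoint T pp hp30 hp2 ht hpt hpole x₀
  exact div_mul_le_mul_differentOrd_of_pow_prime_eq (pp : ℕ) hπ hy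

/-- **Global form: `2·e(u∣p) − 1 ≤ ord_u(𝔇_{K/ℤ})`** at the place `u = placeOf x₀` of `K` under the fibre point (`d(K_u) =
ord_u(𝔇_{K/ℤ})/e(u|p)`, the tree's `differentOrd_rescaledCompletion`). [cite: SerreLocalFields1979, Ch. III §4 Prop. 10 and §6 Prop. 13]
[cite: Mochizuki2012, IUTchIV Thm. 1.10 p. 22] [claim: Mochizuki2012, status: disputed] -/
theorem GenuineK.sub_one_le_multiplicity_differentIdeal_placeOf_wild_ratPoint {q : ℚ} {l : ℕ}
    (T : Cor22.ThetaVolumeDatumAt (ratPoint q) l)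
    (pp : Nat.Primes) (hp30 : (pp : ℕ) ∣ 30) (hp2 : (pp : ℕ) ≠ 2) {t : ℕ} (ht : 0 < t) (hpt : ¬ (pp : ℕ) ∣ t)
    (hpole : ∀ v : HeightOneSpectrum (𝓞 ℚ), Rat.HeightOneSpectrum.natGenerator v = pp →
      Literature.IUT.LogVolume.ord ℚ v (Cor22.jInv q) = -(2 * (t : ℤ))) :
    letI := T.instFieldF; letI := T.instNumberFieldF; letI := T.instAlgebraF; letI := T.instFieldK
    letI := T.instNumberFieldK; letI := T.instAlgebraK; letI := T.instFieldFbar; letI := T.instAlgebraFbar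
    letI := T.instAlgebraKFbar; letI := T.instIsElliptic
    haveI : Fact (pp : ℕ).Prime := ⟨pp.2⟩
    ∀ x₀ : (thetaIndex (pilotDataOfK T.D T.K)).Fibre (.inr pp),
      2 * (placeOf (pilotDataOfK T.D T.K) pp.1 x₀).asIdeal.ramificationIdx ℤ - 1 ≤
        multiplicity (placeOf (pilotDataOfK T.D T.K) pp.1 x₀).asIdeal (differentIdeal ℤ (𝓞 T.K)) := by
  letI := T.instFieldF; letI := T.instNumberFieldF; letI := T.instAlgebraF; letI := T.instFieldK
  letI := T.instNumberFieldK; letI := T.instAlgebraK; letI := T.instFieldFbar; letI := T.instAlgebraFbar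
  letI := T.instAlgebraKFbar; letI := T.instIsElliptic
  haveI : Fact (pp : ℕ).Prime := ⟨pp.2⟩
  set X := pilotDataOfK T.D T.K with hXdef
  intro x₀
  set u := placeOf X pp.1 x₀ with hudef
  have hpu : ((pp : ℕ) : 𝓞 T.K) ∈ u.asIdeal := natCast_mem_placeOf X pp.1 x₀
  have h := GenuineK.sub_one_div_le_differentOrd_kOf_wild_ratPoint T pp hp30 hp2 ht hpt hpole x₀
  have he : absRamificationIdx (pp : ℕ) (kOf X pp.1 x₀) = u.asIdeal.ramificationIdx ℤ := by
    rw [show absRamificationIdx (pp : ℕ) (kOf X pp.1 x₀) =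
        absRamificationIdx (pp : ℕ) (RescaledCompletion T.K pp.1 (placeOf X pp.1 x₀) hpu) from rfl,
      absRamificationIdx_rescaledCompletion]
  have hd : differentOrd (pp : ℕ) (kOf X pp.1 x₀) =
      (multiplicity u.asIdeal (differentIdeal ℤ (𝓞 T.K)) : ℝ) / (u.asIdeal.ramificationIdx ℤ : ℝ) := by
    rw [show differentOrd (pp : ℕ) (kOf X pp.1 x₀) =
        differentOrd (pp : ℕ) (RescaledCompletion T.K pp.1 (placeOf X pp.1 x₀) hpu) from rfl,
      differentOrd_rescaledCompletion]
  rw [he, hd] at h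
  have he0 : (0 : ℝ) < (u.asIdeal.ramificationIdx ℤ : ℝ) := by exact_mod_cast Ideal.ramificationIdx_pos _ _
  rw [div_le_div_iff_of_pos_right he0] at h
  exact_mod_cast h

end Summit.ABC.IUTFork.Conditional

end
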